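import Literature.MathematicalPhysics.QuantumFieldTheory.Balaban1983to89.B5G183RateW1BlockR

/-!
# Bałaban [CMP 95 (1984)] (1.83)/(1.89) at `U = 1`: the CENTRE x-BLOCK PIECES `C1`, `C2` of the
order-two eta-rate in the currency `W∂_ν ⊗ W∂_{ν′}` (ONE King weight per derivative) have the full rate

HONEST FRAMING (cell `pub-balaban`, T⁴ programme, estimate NE2 = U1a «η-rate, linear theory»).  Finite
torus, lattice spacing `η = 1/n`, trivial background `U = 1`, one nonzero reduced momentum `p′ = s` at a
time, `ℓ²`-operator norm on the alias classes `× Fin d`.  Nothing here is about infinite volume, `U ≠ 1`,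
a mass gap, or any summit statement.  Bałaban prints NO rate; the currency, King's pairing `ι`/`plant`
and every constant are OURS ([folklore]).

WHAT IS PRINTED.  [Balaban1984PropagatorsI] p. 31 (1.83): the second term of `G(p′)`,
`−a Σ_μ φ_μ⁻¹ x_μ ⊗ x̄_μ`, whose vector `x_μ(l)` has the CENTRE component `l = 0` (b05 splits it off as
`(wx_μ)° =` the centre-supported vector, blocks `C1 = cR (wx)° ⊗ (wx)′`, `C2 = cR (wx)′ ⊗ (wx)°`);
p. 32 (1.85) `φ_μ(p′) = 1 + a Σ_l |u v_μ|²(p′+l)/Δ(p′+l)` («the additional factor Δ₀» mechanism: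
`aφ_μ⁻¹ ≤ κΔ₀/c_uv`); p. 33: «Proposition 1.1. The operator G is a symmetric operator on L²(T_η) and
‖GJ‖, ‖∇GJ‖, ‖G∇*J‖, ‖∇G∇*J‖, ‖∇∇GJ‖, ‖G∇*∇*J‖ ≤ γ₀⁻¹‖J‖, (1.89)».  [King1986] p. 672: «To analyze the
m = 0 term in (4.19), we successively replace each factor by the corresponding one … and bound the
error.»  (renders ref1 p015–p017, king p024/p025 read as images by this seat.)

WHAT THIS MODULE PROVES (kernel, [folklore]).  The THIRD and FOURTH of the five piece differences of
`B5G183RatePieces.residual_eq_pieces` for the typed residual `B5G183RateO2Op.OrderTwoOpRateResidualW1`: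
 §1 centre facts of Bałaban's fibre: `xo_zero`/`xo_ne` (b05's centre vector is `w(0)·xP(p′)` at the
    centre and `0` elsewhere), `l2n_xo_eq`, `norm_xP_le_Dq` (`|x_μ(p′)| ≤ D(p′) = π²/(4|p′|²)` at every
    level), `xP_centre_rate` (`|xP^{(N)}(p′) − xP^{(RN)}(p′)| ≤ A_x dπ D(p′)/N`, `B5G183RateSum.xP_rate_le`
    at the centre class), **`coef_Dq_le`** (`aφ_μ⁻¹·D(p′) ≤ Cc(d)` — b05 `Fiber.inv_φ_le` and
    `Δ₀(p′)D(p′) ≤ π²/4`), `centre_size_le` (`aφ^{(n)⁻¹}_μ·|(W∂x_μ)°^{(m)}|₂ ≤ πCc`, any two levels),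
    `cR_diff_le'` (`‖cR^{(RN)}_μ − cR^{(N)}_μ‖ ≤ aφ^{(RN)⁻¹}_μ · aC_φ/N²`);
 §2 `sum_sq_xo_diff`, **`centre_rate_le`** (`aφ^{(N)⁻¹}_μ·|(W∂x_μ)°^{(RN)} − extV (W∂x_μ)°^{(N)}|₂
    ≤ CK2(d)/N`: weight rate `6π²/N` and `xP_centre_rate`);
 §3 **`opNorm_C1_piece_W1_le`**, **`opNorm_C2_piece_W1_le`** (each `≤ CCW1(d,a)/N`, the trilinear split
    `B5G183RatePieces.opNorm_blockR_sub_blockR_le` with §1–§2 and `B5G183RateW1BlockR.l2n_xw_diff_le`),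
    and **`residualW1_le_four_pieces_add_T`**: the `W∂ ⊗ W∂` residual is `≤ (CdgW1 + CRW1 + 2CCW1)/N +`
    the ONE remaining piece difference `T` (rank one, vectors `b`, coefficient `(aΦ)⁻¹`).

WHAT REMAINS / NOT CLAIMED: the rank-one piece `T` of the `W∂ ⊗ W∂` residual;
`OrderTwoOpRateResidualW1` stays OPEN; nothing about print.
-/

noncomputable section

namespace Literature.MathematicalPhysics.QuantumFieldTheory.Balaban1983to89.B5G183RateW1BlockC

open scoped BigOperators ComplexConjugate Matrix.Norms.L2Operator
open Finset Complex
open Literature.MathematicalPhysics.QuantumFieldTheory.Balaban1983to89.B4Strip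
open Literature.MathematicalPhysics.QuantumFieldTheory.Balaban1983to89.B5Prop11Leaves
open Literature.MathematicalPhysics.QuantumFieldTheory.Balaban1983to89.B5Prop11Fiber
open Literature.MathematicalPhysics.QuantumFieldTheory.Balaban1983to89.B5Prop11Bound
open Literature.MathematicalPhysics.QuantumFieldTheory.Balaban1983to89.B5Hk163Rate
open Literature.MathematicalPhysics.QuantumFieldTheory.Balaban1983to89.B5Hk163RateSum
open Literature.MathematicalPhysics.QuantumFieldTheory.Balaban1983to89.B5G183Rate
open Literature.MathematicalPhysics.QuantumFieldTheory.Balaban1983to89.B5G183RateSum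
open Literature.MathematicalPhysics.QuantumFieldTheory.Balaban1983to89.B5G183RateL2
open Literature.MathematicalPhysics.QuantumFieldTheory.Balaban1983to89.B5G183RateOp
open Literature.MathematicalPhysics.QuantumFieldTheory.Balaban1983to89.B5G183RateO2Diag
open Literature.MathematicalPhysics.QuantumFieldTheory.Balaban1983to89.B5G183RateO2Op
open Literature.MathematicalPhysics.QuantumFieldTheory.Balaban1983to89.B5G183RatePieces
open Literature.MathematicalPhysics.QuantumFieldTheory.Balaban1983to89.B5G183RateW1Diag
open Literature.MathematicalPhysics.QuantumFieldTheory.Balaban1983to89.B5G183RateW1BlockR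
open Literature.MathematicalPhysics.QuantumFieldTheory.King1986

variable {d : ℕ}

/-! ## §1 Centre facts of Bałaban's fibre [folklore] -/

section LevelN

variable {n : ℕ} [NeZero n]

/-- b05's centre vector at the centre: `(wx_μ)°(0) = w(0)·xP(p′)` (`B5G183Rate.fiber_x_eq` at the
representative `p′` of the centre class). [cite: Balaban1984PropagatorsI, (1.83) p.31] [folklore] -/
theorem xo_zero (hn : 1 ≤ n) (a : ℝ) (ha : 0 < a) {s : Fin d → ℝ} (hs : ∀ ν, |s ν| ≤ Real.pi)
    (hs0 : s ≠ 0) (w : (Fin d → Fin n) → ℂ) (μ : Fin d) :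
    (balabanFiber n hn a ha s hs hs0).xo w μ 0 = w 0 * xP n μ s := by
  have ho : (balabanFiber n hn a ha s hs hs0).o = 0 := rfl
  unfold Fiber.xo
  rw [if_pos ho.symm, ho, fiber_x_eq hn a ha s hs hs0 (isRep_symmAlias hn 0 hs) μ, symmAlias_zero hn hs]

/-- b05's centre vector vanishes off the centre. [folklore] -/
theorem xo_ne (hn : 1 ≤ n) (a : ℝ) (ha : 0 < a) {s : Fin d → ℝ} (hs : ∀ ν, |s ν| ≤ Real.pi)
    (hs0 : s ≠ 0) (w : (Fin d → Fin n) → ℂ) (μ : Fin d) {K : Fin d → Fin n} (hK : K ≠ 0) :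
    (balabanFiber n hn a ha s hs hs0).xo w μ K = 0 := by
  have hK' : K ≠ (balabanFiber n hn a ha s hs hs0).o := hK
  unfold Fiber.xo
  rw [if_neg hK']

/-- `|(wx_μ)°|₂ = |w(0)|·|xP(p′)|`. [folklore] -/
theorem l2n_xo_eq (hn : 1 ≤ n) (a : ℝ) (ha : 0 < a) {s : Fin d → ℝ} (hs : ∀ ν, |s ν| ≤ Real.pi)
    (hs0 : s ≠ 0) (w : (Fin d → Fin n) → ℂ) (μ : Fin d) :
    l2n ((balabanFiber n hn a ha s hs hs0).xo w μ) = ‖w 0‖ * ‖xP n μ s‖ := by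
  rw [Fiber.l2n_xo, ← Fiber.norm_x]
  have ho : (balabanFiber n hn a ha s hs hs0).o = 0 := rfl
  rw [ho, fiber_x_eq hn a ha s hs hs0 (isRep_symmAlias hn 0 hs) μ, symmAlias_zero hn hs]

/-- `|xP^{(n)}_μ(p′)| ≤ D(p′) = π²/(4|p′|²)` (`B5G183RateSum.norm_xP_le_xM` at the centre class,
`xMaj_self`). [cite: King1986, (4.20)–(4.21) p.672] [folklore] -/
theorem norm_xP_le_Dq (hn : 1 ≤ n) {s : Fin d → ℝ} (hs : ∀ ν, |s ν| ≤ Real.pi) (hs0 : s ≠ 0)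
    (μ : Fin d) : ‖xP n μ s‖ ≤ Dq s := by
  obtain ⟨ν₀, hν₀⟩ : ∃ ν, s ν ≠ 0 := Function.ne_iff.mp hs0
  have h := norm_xP_le_xM (N := n) hn le_rfl hn hs ν₀ hν₀ μ (0 : Fin d → Fin n)
  unfold xM at h
  rwa [symmAlias_zero hn hs, xMaj_self] at h

/-- the centre constant `Cc := κ/c_uv · π²/4` with b05's `κ = π²/4`, `c_uv = (4/π²)^{d+1}`. [folklore] -/
def Cc (d : ℕ) : ℝ := Real.pi ^ 2 / 4 / (4 / Real.pi ^ 2) ^ (d + 1) * (Real.pi ^ 2 / 4)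

omit [NeZero n] in
/-- `0 ≤ Cc`. [folklore] -/
theorem Cc_nonneg (d : ℕ) : 0 ≤ Cc d := by unfold Cc; positivity

/-- **«the additional factor Δ₀»:** `aφ_μ(p′)⁻¹ · D(p′) ≤ Cc(d)` — b05 `Fiber.inv_φ_le`
(`φ_μ⁻¹ ≤ κΔ₀/(a c_uv)`) and `Δ₀(p′)D(p′) ≤ π²/4`. [cite: Balaban1984PropagatorsI, (1.85) p.32]
[folklore] -/
theorem coef_Dq_le (hn : 1 ≤ n) (a : ℝ) (ha : 0 < a) {s : Fin d → ℝ} (hs : ∀ ν, |s ν| ≤ Real.pi)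
    (hs0 : s ≠ 0) (μ : Fin d) :
    a / (balabanFiber n hn a ha s hs hs0).φ μ * Dq s ≤ Cc d := by
  obtain ⟨ν₀, hν₀⟩ : ∃ ν, s ν ≠ 0 := Function.ne_iff.mp hs0
  set F := balabanFiber n hn a ha s hs hs0 with hF
  have h1 := F.inv_φ_le μ
  have hκ : F.κ = Real.pi ^ 2 / 4 := rfl
  have hcuv : F.cuv = (4 / Real.pi ^ 2) ^ (d + 1) := rfl
  have ha' : F.a = a := rfl
  have hΔ₀ : F.Δ₀ = Delta1r 0 s := by
    show (∑ μ, ‖d1Sym s μ‖ ^ 2) = Delta1r 0 s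
    exact (Delta0_eq s).symm
  rw [hκ, hcuv, ha', hΔ₀] at h1
  have hD := Dq_nonneg s
  have hDD := Delta1r_mul_Dq_le hs ν₀ hν₀
  have hφ := F.φ_pos μ
  have hc : (0 : ℝ) < (4 / Real.pi ^ 2) ^ (d + 1) := by positivity
  calc a / F.φ μ * Dq s = a * (1 / F.φ μ) * Dq s := by rw [mul_one_div]
    _ ≤ a * (Real.pi ^ 2 / 4 * Delta1r 0 s / (a * (4 / Real.pi ^ 2) ^ (d + 1))) * Dq s := by
        gcongr
    _ = Real.pi ^ 2 / 4 / (4 / Real.pi ^ 2) ^ (d + 1) * (Delta1r 0 s * Dq s) := by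
        field_simp
    _ ≤ Real.pi ^ 2 / 4 / (4 / Real.pi ^ 2) ^ (d + 1) * (Real.pi ^ 2 / 4) := by gcongr
    _ = Cc d := rfl

end LevelN

section TwoLevels

variable {n m : ℕ} [NeZero n] [NeZero m]

/-- **centre size, any two levels:** `aφ^{(n)}_μ(p′)⁻¹ · |(W∂_ν x_μ)°^{(m)}|₂ ≤ π·Cc(d)`
(`|W∂| ≤ π`, `|xP^{(m)}(p′)| ≤ D(p′)`, `coef_Dq_le`). [folklore] -/
theorem centre_size_le (hn : 1 ≤ n) (hm : 1 ≤ m) (a : ℝ) (ha : 0 < a) {s : Fin d → ℝ}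
    (hs : ∀ ν, |s ν| ≤ Real.pi) (hs0 : s ≠ 0) (ν μ : Fin d) :
    a / (balabanFiber n hn a ha s hs hs0).φ μ
        * l2n ((balabanFiber m hm a ha s hs hs0).xo (fun K => w1dSym m K s ν) μ)
      ≤ Real.pi * Cc d := by
  rw [l2n_xo_eq hm a ha hs hs0]
  have hw := norm_w1dSym_le hm (0 : Fin d → Fin m) hs ν
  have hx := norm_xP_le_Dq hm hs hs0 μ
  have hφ := (balabanFiber n hn a ha s hs hs0).φ_pos μ
  have hc := coef_Dq_le hn a ha hs hs0 μ
  have h0 : 0 ≤ a / (balabanFiber n hn a ha s hs hs0).φ μ := div_nonneg ha.le hφ.le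
  calc a / (balabanFiber n hn a ha s hs hs0).φ μ * (‖w1dSym m 0 s ν‖ * ‖xP m μ s‖)
      ≤ a / (balabanFiber n hn a ha s hs hs0).φ μ * (Real.pi * Dq s) := by
        exact mul_le_mul_of_nonneg_left (mul_le_mul hw hx (norm_nonneg _) Real.pi_pos.le) h0
    _ = Real.pi * (a / (balabanFiber n hn a ha s hs hs0).φ μ * Dq s) := by ring
    _ ≤ Real.pi * Cc d := by gcongr

end TwoLevels

/-! ## §2 The centre rates [folklore] -/

section Rate

variable {N R : ℕ} [NeZero N] [NeZero R]

omit [NeZero R] in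
/-- **the x-vector eta-rate AT THE CENTRE:** `|xP^{(N)}_μ(p′) − xP^{(RN)}_μ(p′)| ≤ A_x dπ/N · D(p′)`
(`B5G183RateSum.xP_rate_le` at the centre class; `Σ_ν|p′_ν| ≤ dπ`). [cite: King1986, (4.29)/(4.31)
p.673] [folklore] -/
theorem xP_centre_rate (hN : 1 ≤ N) (hR : 1 ≤ R) {s : Fin d → ℝ} (hs : ∀ ν, |s ν| ≤ Real.pi)
    (hs0 : s ≠ 0) (μ : Fin d) :
    ‖xP N μ s - xP (R * N) μ s‖ ≤ Ax d * d * Real.pi / N * Dq s := by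
  obtain ⟨ν₀, hν₀⟩ : ∃ ν, s ν ≠ 0 := Function.ne_iff.mp hs0
  have hN0 : (0 : ℝ) < N := by exact_mod_cast hN
  have h := xP_rate_le (R := R) hN hR hs ν₀ hν₀ μ (0 : Fin d → Fin N)
  unfold xe xM at h
  rw [symmAlias_zero hN hs, xMaj_self] at h
  have hsum : ∑ ν, |s ν| ≤ d * Real.pi := by
    calc ∑ ν, |s ν| ≤ ∑ _ν : Fin d, Real.pi := Finset.sum_le_sum fun ν _ => hs ν
      _ = d * Real.pi := by simp
  have hA : 0 ≤ Ax d := by unfold Ax; positivity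
  have hD := Dq_nonneg s
  calc ‖xP N μ s - xP (R * N) μ s‖ ≤ Ax d * ((∑ ν, |s ν|) / N) * Dq s := h
    _ ≤ Ax d * (d * Real.pi / N) * Dq s := by gcongr
    _ = Ax d * d * Real.pi / N * Dq s := by ring

/-- the weight rate at the centre: `|W∂^{(RN)}_ν(p′) − W∂^{(N)}_ν(p′)| ≤ 6π²/N`
(`B5G183RatePieces.w1dSym_weight_hyps` at the centre class). [folklore] -/
theorem w1_centre_rate (hN : 1 ≤ N) (hR : 1 ≤ R) {s : Fin d → ℝ} (hs : ∀ ν, |s ν| ≤ Real.pi)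
    (ν : Fin d) : ‖w1dSym (R * N) 0 s ν - w1dSym N 0 s ν‖ ≤ 6 * Real.pi ^ 2 / N := by
  have hN0 : (0 : ℝ) < N := by exact_mod_cast hN
  have h := (w1dSym_weight_hyps (N := N) (R := R) hN hR hs ν).2 0
  rw [iota_zero hN hs, symmAlias_zero hN hs] at h
  have hsn := norm_le_pi hs
  calc ‖w1dSym (R * N) 0 s ν - w1dSym N 0 s ν‖ ≤ 6 * ‖s‖ ^ 2 / N := h
    _ ≤ 6 * Real.pi ^ 2 / N := by gcongr

/-- the squared `ℓ²` distance of the centre vectors between the levels is the centre term alone: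
`Σ_K |(W∂x_μ)°^{(RN)}(K) − extV (W∂x_μ)°^{(N)}(K)|² = |W∂^{(RN)}(p′)xP^{(RN)}(p′) − W∂^{(N)}(p′)xP^{(N)}(p′)|²`.
[folklore] -/
theorem sum_sq_xo_diff (hN : 1 ≤ N) (hRN : 1 ≤ R * N) (a : ℝ) (ha : 0 < a)
    {s : Fin d → ℝ} (hs : ∀ ν, |s ν| ≤ Real.pi) (hs0 : s ≠ 0) (ν μ : Fin d) :
    ∑ K, ‖(balabanFiber (R * N) hRN a ha s hs hs0).xo (fun K => w1dSym (R * N) K s ν) μ K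
        - extV R s ((balabanFiber N hN a ha s hs hs0).xo (fun k => w1dSym N k s ν)) μ K‖ ^ 2
      = ‖w1dSym (R * N) 0 s ν * xP (R * N) μ s - w1dSym N 0 s ν * xP N μ s‖ ^ 2 := by
  rw [sum_sq_sub_extV hN hs, ← Finset.add_sum_erase _ _ (Finset.mem_univ (0 : Fin d → Fin N)),
    iota_zero hN hs, xo_zero hRN a ha hs hs0, xo_zero hN a ha hs hs0]
  have h1 : ∑ k ∈ Finset.univ.erase (0 : Fin d → Fin N),
      ‖(balabanFiber (R * N) hRN a ha s hs hs0).xo (fun K => w1dSym (R * N) K s ν) μ (iota R k s)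
        - (balabanFiber N hN a ha s hs hs0).xo (fun k => w1dSym N k s ν) μ k‖ ^ 2 = 0 := by
    refine Finset.sum_eq_zero fun k hk => ?_
    have hk0 : k ≠ 0 := (Finset.mem_erase.mp hk).1
    have hK : iota R k s ≠ 0 := fun h => hk0 (iota_injective hN hs (h.trans (iota_zero hN hs).symm))
    rw [xo_ne hRN a ha hs hs0 _ μ hK, xo_ne hN a ha hs hs0 _ μ hk0, sub_zero, norm_zero,
      zero_pow two_ne_zero]
  have h2 : ∑ K ∈ Finset.univ.filter (fun K => ∀ k : Fin d → Fin N, iota R k s ≠ K),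
      ‖(balabanFiber (R * N) hRN a ha s hs hs0).xo (fun K => w1dSym (R * N) K s ν) μ K‖ ^ 2 = 0 := by
    refine Finset.sum_eq_zero fun K hK => ?_
    have hu := (Finset.mem_filter.mp hK).2
    have hK0 : K ≠ 0 := fun h => hu 0 ((iota_zero hN hs).trans h.symm)
    rw [xo_ne hRN a ha hs hs0 _ μ hK0, norm_zero, zero_pow two_ne_zero]
  rw [h1, h2, add_zero, add_zero]

/-- the centre-rate constant `Cc·(6π² + π²A_x d)`. [folklore] -/
def CK2 (d : ℕ) : ℝ := Cc d * (6 * Real.pi ^ 2 + Real.pi ^ 2 * (Ax d * d))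

omit [NeZero N] [NeZero R] in
/-- `0 ≤ CK2`. [folklore] -/
theorem CK2_nonneg (d : ℕ) : 0 ≤ CK2 d := by
  have hA : 0 ≤ Ax d := by unfold Ax; positivity
  have hc := Cc_nonneg d
  unfold CK2; positivity

/-- **centre rate:** `aφ^{(N)}_μ(p′)⁻¹ · |(W∂_ν x_μ)°^{(RN)} − extV (W∂_ν x_μ)°^{(N)}|₂ ≤ CK2(d)/N` — the
weight rate `6π²/N` against `|xP^{(RN)}(p′)| ≤ D(p′)`, and `|W∂^{(N)}(p′)| ≤ π` against the centre x-rate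
`A_x dπ D(p′)/N`, both paid by «the additional factor Δ₀» (`coef_Dq_le`). [cite: King1986, (4.19) p.672;
Balaban1984PropagatorsI, (1.85) p.32] [folklore] -/
theorem centre_rate_le (hN : 1 ≤ N) (hR : 1 ≤ R) (hRN : 1 ≤ R * N) (a : ℝ) (ha : 0 < a)
    {s : Fin d → ℝ} (hs : ∀ ν, |s ν| ≤ Real.pi) (hs0 : s ≠ 0) (ν μ : Fin d) :
    a / (balabanFiber N hN a ha s hs hs0).φ μ
        * l2n ((balabanFiber (R * N) hRN a ha s hs hs0).xo (fun K => w1dSym (R * N) K s ν) μ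
            - extV R s ((balabanFiber N hN a ha s hs hs0).xo (fun k => w1dSym N k s ν)) μ)
      ≤ CK2 d / N := by
  have hN0 : (0 : ℝ) < N := by exact_mod_cast hN
  have hφ := (balabanFiber N hN a ha s hs hs0).φ_pos μ
  have h0 : 0 ≤ a / (balabanFiber N hN a ha s hs hs0).φ μ := div_nonneg ha.le hφ.le
  have hD := Dq_nonneg s
  have hA : 0 ≤ Ax d := by unfold Ax; positivity
  have hxR := norm_xP_le_Dq hRN hs hs0 μ
  have hwN := norm_w1dSym_le hN (0 : Fin d → Fin N) hs ν
  have hdw := w1_centre_rate (N := N) (R := R) hN hR hs ν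
  have hdx := xP_centre_rate (N := N) (R := R) hN hR hs hs0 μ
  have hc := coef_Dq_le hN a ha hs hs0 μ
  -- the `ℓ²` distance is the centre term
  set B : ℝ := 6 * Real.pi ^ 2 / N * Dq s + Real.pi * (Ax d * d * Real.pi / N * Dq s) with hB
  have hB0 : 0 ≤ B := by positivity
  have hz : ‖w1dSym (R * N) 0 s ν * xP (R * N) μ s - w1dSym N 0 s ν * xP N μ s‖ ≤ B := by
    have e : w1dSym (R * N) 0 s ν * xP (R * N) μ s - w1dSym N 0 s ν * xP N μ s
        = (w1dSym (R * N) 0 s ν - w1dSym N 0 s ν) * xP (R * N) μ s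
          + w1dSym N 0 s ν * (xP (R * N) μ s - xP N μ s) := by ring
    rw [e]
    refine (norm_add_le _ _).trans ?_
    rw [norm_mul, norm_mul, norm_sub_rev (xP (R * N) μ s)]
    exact add_le_add (mul_le_mul hdw hxR (norm_nonneg _) (by positivity))
      (mul_le_mul hwN hdx (norm_nonneg _) Real.pi_pos.le)
  have hl : l2n ((balabanFiber (R * N) hRN a ha s hs hs0).xo (fun K => w1dSym (R * N) K s ν) μ
      - extV R s ((balabanFiber N hN a ha s hs hs0).xo (fun k => w1dSym N k s ν)) μ) ≤ B := by
    refine l2n_le_of_sq_le hB0 ?_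
    have h := sum_sq_xo_diff hN hRN a ha hs hs0 ν μ
    simp only [Pi.sub_apply] at h ⊢
    rw [h]
    exact pow_le_pow_left₀ (norm_nonneg _) hz 2
  calc _ ≤ a / (balabanFiber N hN a ha s hs hs0).φ μ * B := by gcongr
    _ = (a / (balabanFiber N hN a ha s hs hs0).φ μ * Dq s)
          * ((6 * Real.pi ^ 2 + Real.pi ^ 2 * (Ax d * d)) / N) := by rw [hB]; field_simp
    _ ≤ Cc d * ((6 * Real.pi ^ 2 + Real.pi ^ 2 * (Ax d * d)) / N) := by gcongr
    _ = CK2 d / N := by unfold CK2; ring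

/-- **finer coefficient rate:** `‖cR^{(RN)}_μ − cR^{(N)}_μ‖ ≤ aφ^{(RN)}_μ⁻¹ · aC_φ/N²` (keeps the factor
`aφ⁻¹` that pays the centre vector; `B5QGQ199Rate.phiMu_rate`, `φ^{(N)} ≥ 1`).
[cite: Balaban1984PropagatorsI, (1.84)–(1.85) p.32] [folklore] -/
theorem cR_diff_le' (hN : 1 ≤ N) (hR : 1 ≤ R) (hRN : 1 ≤ R * N) (a : ℝ) (ha : 0 < a)
    {s : Fin d → ℝ} (hs : ∀ ν, |s ν| ≤ Real.pi) (hs0 : s ≠ 0) (μ : Fin d) :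
    ‖(balabanFiber (R * N) hRN a ha s hs hs0).cR μ - (balabanFiber N hN a ha s hs hs0).cR μ‖
      ≤ a / (balabanFiber (R * N) hRN a ha s hs hs0).φ μ
          * (a * B5ActionRate166.Cphi / (N : ℝ) ^ 2) := by
  obtain ⟨ν₀, hν₀⟩ : ∃ ν, s ν ≠ 0 := Function.ne_iff.mp hs0
  have hφR := fiber_φ_eq hRN a ha s hs hs0 μ
  have hφN := fiber_φ_eq hN a ha s hs hs0 μ
  have haR : (balabanFiber (R * N) hRN a ha s hs hs0).a = a := rfl
  have haN : (balabanFiber N hN a ha s hs hs0).a = a := rfl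
  have h := B5QGQ199Rate.phiMu_rate (N := N) (R := R) hN hR a ha.le μ s hs ν₀ hν₀
  have hpR := B5QGQ199Rate.phiMu_pos (n := R * N) a ha.le μ s
  have hpN := B5QGQ199Rate.phiMu_pos (n := N) a ha.le μ s
  have hpN1 : 1 ≤ phiMu N a μ s := by
    rw [← hφN]; exact (balabanFiber N hN a ha s hs hs0).one_le_φ μ
  unfold Fiber.cR
  rw [haR, haN, hφR, hφN]
  have e : -((a : ℂ) / (phiMu (R * N) a μ s : ℂ)) - -((a : ℂ) / (phiMu N a μ s : ℂ))
      = ((a / phiMu (R * N) a μ s * ((phiMu (R * N) a μ s - phiMu N a μ s) / phiMu N a μ s) : ℝ)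
          : ℂ) := by
    have h1 : (phiMu (R * N) a μ s : ℂ) ≠ 0 := by exact_mod_cast hpR.ne'
    have h2 : (phiMu N a μ s : ℂ) ≠ 0 := by exact_mod_cast hpN.ne'
    push_cast
    field_simp
    ring
  rw [e, Complex.norm_real, Real.norm_eq_abs, abs_mul, abs_of_pos (div_pos ha hpR), abs_div,
    abs_of_pos hpN, abs_sub_comm]
  have h0 : 0 ≤ a / phiMu (R * N) a μ s := (div_pos ha hpR).le
  refine mul_le_mul_of_nonneg_left ?_ h0
  calc |phiMu N a μ s - phiMu (R * N) a μ s| / phiMu N a μ s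
      ≤ |phiMu N a μ s - phiMu (R * N) a μ s| / 1 := by gcongr
    _ ≤ a * (B5ActionRate166.Cphi * ((N : ℝ) ^ 2)⁻¹) := by rw [div_one]; exact h
    _ = a * B5ActionRate166.Cphi / (N : ℝ) ^ 2 := by ring

end Rate

/-! ## §3 The centre x-block pieces `C1`, `C2` of the `W∂ ⊗ W∂` residual are `O(1/N)` [folklore] -/

section Main

variable {N R : ℕ} [NeZero N] [NeZero R]

/-- constant of the pieces `C1`, `C2`: `πCc·(aC_φ + √XR2) + CK2`. [folklore] -/
def CCW1 (d : ℕ) (a : ℝ) : ℝ :=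
  Real.pi * Cc d * (a * B5ActionRate166.Cphi + Real.sqrt (XR2 d)) + CK2 d

omit [NeZero N] [NeZero R] in
/-- `0 ≤ CCW1` for `0 ≤ a`. [folklore] -/
theorem CCW1_nonneg (d : ℕ) {a : ℝ} (ha : 0 ≤ a) : 0 ≤ CCW1 d a := by
  have hC := B5ActionRate166.Cphi_pos
  have hc := Cc_nonneg d
  have hk := CK2_nonneg d
  unfold CCW1; positivity

/-- **THE CENTRE x-BLOCK PIECE `C1 = cR (W∂_ν x)° ⊗ (W∂_{ν′} x)′` OF THE `W∂ ⊗ W∂` ORDER-TWO eta-RATE IS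
`O(1/N)`.** Trilinear split `B5G183RatePieces.opNorm_blockR_sub_blockR_le`: the coefficient rate
`cR_diff_le'` against the centre size (`centre_size_le`), the centre rate `centre_rate_le`, and the
off-centre vector rate `B5G183RateW1BlockR.l2n_xw_diff_le` against the centre size.
[cite: Balaban1984PropagatorsI, (1.83) p.31, (1.85) p.32, Prop. 1.1 (1.89) p.33; King1986, (4.19)–(4.20)
p.672] [folklore] -/
theorem opNorm_C1_piece_W1_le (hN : 1 ≤ N) (hR : 1 ≤ R) (hRN : 1 ≤ R * N) (a : ℝ) (ha : 0 < a)
    {s : Fin d → ℝ} (hs : ∀ ν, |s ν| ≤ Real.pi) (hs0 : s ≠ 0) (ν ν' : Fin d) :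
    let F := balabanFiber (R * N) hRN a ha s hs hs0
    let F' := balabanFiber N hN a ha s hs hs0
    ‖blockR F.cR (F.xo fun K => w1dSym (R * N) K s ν) (F.xw fun K => w1dSym (R * N) K s ν')
        - blockR F'.cR (extV R s (F'.xo fun k => w1dSym N k s ν))
            (extV R s (F'.xw fun k => w1dSym N k s ν'))‖
      ≤ CCW1 d a / N := by
  intro F F'
  have hN0 : (0 : ℝ) < N := by exact_mod_cast hN
  have hN1 : (1 : ℝ) ≤ N := by exact_mod_cast hN
  have hC := B5ActionRate166.Cphi_pos
  have hc := Cc_nonneg d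
  have hk := CK2_nonneg d
  have hX : 0 ≤ Real.sqrt (XR2 d) := Real.sqrt_nonneg _
  have hszR := fun μ => l2n_xw_w1_le_one hRN a ha hs hs0 ν ν' μ
  have hszN := fun μ => l2n_xw_w1_le_one hN a ha hs hs0 ν ν' μ
  have hcRN : ∀ μ, ‖F'.cR μ‖ = a / F'.φ μ := fun μ => by rw [Fiber.norm_cR]; rfl
  have hφR := fun μ => F.φ_pos μ
  have hφN := fun μ => F'.φ_pos μ
  have hcd := fun μ => cR_diff_le' hN hR hRN a ha hs hs0 μ
  have hcsR := fun μ => centre_size_le hRN hRN a ha hs hs0 ν μ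
  have hcsN := fun μ => centre_size_le hN hN a ha hs hs0 ν μ
  have hcr := fun μ => centre_rate_le hN hR hRN a ha hs hs0 ν μ
  have hvb := fun μ => l2n_xw_diff_le hN hR hRN a ha hs hs0 ν' μ
  have key := opNorm_blockR_sub_blockR_le F.cR F'.cR
    (F.xo fun K => w1dSym (R * N) K s ν) (extV R s (F'.xo fun k => w1dSym N k s ν))
    (F.xw fun K => w1dSym (R * N) K s ν') (extV R s (F'.xw fun k => w1dSym N k s ν'))
    (K₁ := Real.pi * Cc d * (a * B5ActionRate166.Cphi / (N : ℝ) ^ 2)) (K₂ := CK2 d / N)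
    (K₃ := Real.pi * Cc d * (Real.sqrt (XR2 d) / N)) (by positivity) (by positivity) (by positivity)
    (fun μ => by
      have h0 : 0 ≤ l2n (F.xo (fun K => w1dSym (R * N) K s ν) μ) := l2n_nonneg _
      have hB0 : 0 ≤ a / F.φ μ * (a * B5ActionRate166.Cphi / (N : ℝ) ^ 2) :=
        mul_nonneg (div_nonneg ha.le (hφR μ).le) (by positivity)
      calc ‖F.cR μ - F'.cR μ‖ * (l2n (F.xo (fun K => w1dSym (R * N) K s ν) μ)
              * l2n (F.xw (fun K => w1dSym (R * N) K s ν') μ))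
          ≤ (a / F.φ μ * (a * B5ActionRate166.Cphi / (N : ℝ) ^ 2))
              * (l2n (F.xo (fun K => w1dSym (R * N) K s ν) μ) * 1) :=
            mul_le_mul (hcd μ) (mul_le_mul_of_nonneg_left (hszR μ).2 h0)
              (mul_nonneg h0 (l2n_nonneg _)) hB0
        _ = (a / F.φ μ * l2n (F.xo (fun K => w1dSym (R * N) K s ν) μ))
              * (a * B5ActionRate166.Cphi / (N : ℝ) ^ 2) := by ring
        _ ≤ Real.pi * Cc d * (a * B5ActionRate166.Cphi / (N : ℝ) ^ 2) :=
            mul_le_mul_of_nonneg_right (hcsR μ) (by positivity))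
    (fun μ => by
      rw [hcRN μ]
      have h0 : 0 ≤ l2n (F.xo (fun K => w1dSym (R * N) K s ν) μ
          - extV R s (F'.xo fun k => w1dSym N k s ν) μ) := l2n_nonneg _
      have hφ0 : 0 ≤ a / F'.φ μ := div_nonneg ha.le (hφN μ).le
      calc a / F'.φ μ * (l2n (F.xo (fun K => w1dSym (R * N) K s ν) μ
              - extV R s (F'.xo fun k => w1dSym N k s ν) μ)
              * l2n (F.xw (fun K => w1dSym (R * N) K s ν') μ))
          ≤ a / F'.φ μ * (l2n (F.xo (fun K => w1dSym (R * N) K s ν) μ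
              - extV R s (F'.xo fun k => w1dSym N k s ν) μ) * 1) :=
            mul_le_mul_of_nonneg_left (mul_le_mul_of_nonneg_left (hszR μ).2 h0) hφ0
        _ = a / F'.φ μ * l2n (F.xo (fun K => w1dSym (R * N) K s ν) μ
              - extV R s (F'.xo fun k => w1dSym N k s ν) μ) := by ring
        _ ≤ CK2 d / N := hcr μ)
    (fun μ => by
      rw [hcRN μ, l2n_extV hN hs]
      have h0 : 0 ≤ l2n (F'.xo (fun k => w1dSym N k s ν) μ) := l2n_nonneg _
      have hφ0 : 0 ≤ a / F'.φ μ := div_nonneg ha.le (hφN μ).le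
      calc a / F'.φ μ * (l2n (F'.xo (fun k => w1dSym N k s ν) μ)
              * l2n (F.xw (fun K => w1dSym (R * N) K s ν') μ
                  - extV R s (F'.xw fun k => w1dSym N k s ν') μ))
          ≤ a / F'.φ μ * (l2n (F'.xo (fun k => w1dSym N k s ν) μ) * (Real.sqrt (XR2 d) / N)) :=
            mul_le_mul_of_nonneg_left (mul_le_mul_of_nonneg_left (hvb μ) h0) hφ0
        _ = (a / F'.φ μ * l2n (F'.xo (fun k => w1dSym N k s ν) μ)) * (Real.sqrt (XR2 d) / N) := by
            ring
        _ ≤ Real.pi * Cc d * (Real.sqrt (XR2 d) / N) :=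
            mul_le_mul_of_nonneg_right (hcsN μ) (by positivity))
  refine key.trans ?_
  have h2 : a * B5ActionRate166.Cphi / (N : ℝ) ^ 2 ≤ a * B5ActionRate166.Cphi / N :=
    div_le_div_of_nonneg_left (by positivity) hN0 (by nlinarith)
  calc Real.pi * Cc d * (a * B5ActionRate166.Cphi / (N : ℝ) ^ 2) + CK2 d / N
        + Real.pi * Cc d * (Real.sqrt (XR2 d) / N)
      ≤ Real.pi * Cc d * (a * B5ActionRate166.Cphi / N) + CK2 d / N
        + Real.pi * Cc d * (Real.sqrt (XR2 d) / N) := by gcongr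
    _ = CCW1 d a / N := by unfold CCW1; ring

/-- **THE CENTRE x-BLOCK PIECE `C2 = cR (W∂_ν x)′ ⊗ (W∂_{ν′} x)°` IS `O(1/N)`** (mirror of `C1`; the
middle term pairs the level-`N` coefficient with the level-`RN` centre vector, `centre_size_le` with two
levels). [cite: Balaban1984PropagatorsI, (1.83) p.31, (1.85) p.32, Prop. 1.1 (1.89) p.33; King1986,
(4.19)–(4.20) p.672] [folklore] -/
theorem opNorm_C2_piece_W1_le (hN : 1 ≤ N) (hR : 1 ≤ R) (hRN : 1 ≤ R * N) (a : ℝ) (ha : 0 < a)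
    {s : Fin d → ℝ} (hs : ∀ ν, |s ν| ≤ Real.pi) (hs0 : s ≠ 0) (ν ν' : Fin d) :
    let F := balabanFiber (R * N) hRN a ha s hs hs0
    let F' := balabanFiber N hN a ha s hs hs0
    ‖blockR F.cR (F.xw fun K => w1dSym (R * N) K s ν) (F.xo fun K => w1dSym (R * N) K s ν')
        - blockR F'.cR (extV R s (F'.xw fun k => w1dSym N k s ν))
            (extV R s (F'.xo fun k => w1dSym N k s ν'))‖
      ≤ CCW1 d a / N := by
  intro F F'
  have hN0 : (0 : ℝ) < N := by exact_mod_cast hN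
  have hN1 : (1 : ℝ) ≤ N := by exact_mod_cast hN
  have hC := B5ActionRate166.Cphi_pos
  have hc := Cc_nonneg d
  have hk := CK2_nonneg d
  have hX : 0 ≤ Real.sqrt (XR2 d) := Real.sqrt_nonneg _
  have hszR := fun μ => l2n_xw_w1_le_one hRN a ha hs hs0 ν ν' μ
  have hszN := fun μ => l2n_xw_w1_le_one hN a ha hs hs0 ν ν' μ
  have hcRN : ∀ μ, ‖F'.cR μ‖ = a / F'.φ μ := fun μ => by rw [Fiber.norm_cR]; rfl
  have hφR := fun μ => F.φ_pos μ
  have hφN := fun μ => F'.φ_pos μ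
  have hcd := fun μ => cR_diff_le' hN hR hRN a ha hs hs0 μ
  have hcsRR := fun μ => centre_size_le hRN hRN a ha hs hs0 ν' μ
  have hcsNR := fun μ => centre_size_le hN hRN a ha hs hs0 ν' μ
  have hcr := fun μ => centre_rate_le hN hR hRN a ha hs hs0 ν' μ
  have hva := fun μ => l2n_xw_diff_le hN hR hRN a ha hs hs0 ν μ
  have key := opNorm_blockR_sub_blockR_le F.cR F'.cR
    (F.xw fun K => w1dSym (R * N) K s ν) (extV R s (F'.xw fun k => w1dSym N k s ν))
    (F.xo fun K => w1dSym (R * N) K s ν') (extV R s (F'.xo fun k => w1dSym N k s ν'))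
    (K₁ := Real.pi * Cc d * (a * B5ActionRate166.Cphi / (N : ℝ) ^ 2))
    (K₂ := Real.pi * Cc d * (Real.sqrt (XR2 d) / N)) (K₃ := CK2 d / N)
    (by positivity) (by positivity) (by positivity)
    (fun μ => by
      have h0 : 0 ≤ l2n (F.xo (fun K => w1dSym (R * N) K s ν') μ) := l2n_nonneg _
      have hB0 : 0 ≤ a / F.φ μ * (a * B5ActionRate166.Cphi / (N : ℝ) ^ 2) :=
        mul_nonneg (div_nonneg ha.le (hφR μ).le) (by positivity)
      calc ‖F.cR μ - F'.cR μ‖ * (l2n (F.xw (fun K => w1dSym (R * N) K s ν) μ)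
              * l2n (F.xo (fun K => w1dSym (R * N) K s ν') μ))
          ≤ (a / F.φ μ * (a * B5ActionRate166.Cphi / (N : ℝ) ^ 2))
              * (1 * l2n (F.xo (fun K => w1dSym (R * N) K s ν') μ)) :=
            mul_le_mul (hcd μ) (mul_le_mul_of_nonneg_right (hszR μ).1 h0)
              (mul_nonneg (l2n_nonneg _) h0) hB0
        _ = (a / F.φ μ * l2n (F.xo (fun K => w1dSym (R * N) K s ν') μ))
              * (a * B5ActionRate166.Cphi / (N : ℝ) ^ 2) := by ring
        _ ≤ Real.pi * Cc d * (a * B5ActionRate166.Cphi / (N : ℝ) ^ 2) :=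
            mul_le_mul_of_nonneg_right (hcsRR μ) (by positivity))
    (fun μ => by
      rw [hcRN μ]
      have h0 : 0 ≤ l2n (F.xo (fun K => w1dSym (R * N) K s ν') μ) := l2n_nonneg _
      have hφ0 : 0 ≤ a / F'.φ μ := div_nonneg ha.le (hφN μ).le
      calc a / F'.φ μ * (l2n (F.xw (fun K => w1dSym (R * N) K s ν) μ
              - extV R s (F'.xw fun k => w1dSym N k s ν) μ)
              * l2n (F.xo (fun K => w1dSym (R * N) K s ν') μ))
          ≤ a / F'.φ μ * ((Real.sqrt (XR2 d) / N) * l2n (F.xo (fun K => w1dSym (R * N) K s ν') μ)) :=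
            mul_le_mul_of_nonneg_left (mul_le_mul_of_nonneg_right (hva μ) h0) hφ0
        _ = (a / F'.φ μ * l2n (F.xo (fun K => w1dSym (R * N) K s ν') μ)) * (Real.sqrt (XR2 d) / N) := by
            ring
        _ ≤ Real.pi * Cc d * (Real.sqrt (XR2 d) / N) :=
            mul_le_mul_of_nonneg_right (hcsNR μ) (by positivity))
    (fun μ => by
      rw [hcRN μ, l2n_extV hN hs]
      have h0 : 0 ≤ l2n (F.xo (fun K => w1dSym (R * N) K s ν') μ
          - extV R s (F'.xo fun k => w1dSym N k s ν') μ) := l2n_nonneg _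
      have hφ0 : 0 ≤ a / F'.φ μ := div_nonneg ha.le (hφN μ).le
      calc a / F'.φ μ * (l2n (F'.xw (fun k => w1dSym N k s ν) μ)
              * l2n (F.xo (fun K => w1dSym (R * N) K s ν') μ
                  - extV R s (F'.xo fun k => w1dSym N k s ν') μ))
          ≤ a / F'.φ μ * (1 * l2n (F.xo (fun K => w1dSym (R * N) K s ν') μ
                  - extV R s (F'.xo fun k => w1dSym N k s ν') μ)) :=
            mul_le_mul_of_nonneg_left (mul_le_mul_of_nonneg_right (hszN μ).1 h0) hφ0
        _ = a / F'.φ μ * l2n (F.xo (fun K => w1dSym (R * N) K s ν') μ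
                  - extV R s (F'.xo fun k => w1dSym N k s ν') μ) := by ring
        _ ≤ CK2 d / N := hcr μ)
  refine key.trans ?_
  have h2 : a * B5ActionRate166.Cphi / (N : ℝ) ^ 2 ≤ a * B5ActionRate166.Cphi / N :=
    div_le_div_of_nonneg_left (by positivity) hN0 (by nlinarith)
  calc Real.pi * Cc d * (a * B5ActionRate166.Cphi / (N : ℝ) ^ 2)
        + Real.pi * Cc d * (Real.sqrt (XR2 d) / N) + CK2 d / N
      ≤ Real.pi * Cc d * (a * B5ActionRate166.Cphi / N)
        + Real.pi * Cc d * (Real.sqrt (XR2 d) / N) + CK2 d / N := by gcongr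
    _ = CCW1 d a / N := by unfold CCW1; ring

/-- **consequence for the typed residual:** the `W∂ ⊗ W∂` residual is bounded by
`(CdgW1 + CRW1 + 2·CCW1)/N` plus the ONE remaining piece difference `T` (rank one).
[cite: Balaban1984PropagatorsI, Prop. 1.1 (1.89) p.33; King1986, (4.19) p.672] [folklore] -/
theorem residualW1_le_four_pieces_add_T (hN : 1 ≤ N) (hR : 1 ≤ R) (hRN : 1 ≤ R * N) (a : ℝ)
    (ha : 0 < a) {s : Fin d → ℝ} (hs : ∀ ν, |s ν| ≤ Real.pi) (hs0 : s ≠ 0) (ν ν' : Fin d) :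
    let F := balabanFiber (R * N) hRN a ha s hs hs0
    let F' := balabanFiber N hN a ha s hs hs0
    let wa : (Fin d → Fin (R * N)) → ℂ := fun K => w1dSym (R * N) K s ν
    let wb : (Fin d → Fin (R * N)) → ℂ := fun K => w1dSym (R * N) K s ν'
    let wa' : (Fin d → Fin N) → ℂ := fun k => w1dSym N k s ν
    let wb' : (Fin d → Fin N) → ℂ := fun k => w1dSym N k s ν'
    ‖sandwich wa wb F.G - plant R s (sandwich wa' wb' F'.G)‖
      ≤ (CdgW1 d a + CRW1 d a + 2 * CCW1 d a) / N
        + ‖rankOne F.cT (F.bw wa) (F.bw wb)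
            - rankOne F'.cT (extP R s (F'.bw wa')) (extP R s (F'.bw wb'))‖ := by
  have h1 := residualW1_le_two_pieces_add_three (N := N) (R := R) hN hR hRN a ha hs hs0 ν ν'
  have h2 := opNorm_C1_piece_W1_le hN hR hRN a ha hs hs0 ν ν'
  have h3 := opNorm_C2_piece_W1_le hN hR hRN a ha hs hs0 ν ν'
  dsimp only at h1 h2 h3 ⊢
  have e : (CdgW1 d a + CRW1 d a + 2 * CCW1 d a) / (N : ℝ)
      = (CdgW1 d a + CRW1 d a) / N + CCW1 d a / N + CCW1 d a / N := by ring
  rw [e]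
  linarith

end Main

end Literature.MathematicalPhysics.QuantumFieldTheory.Balaban1983to89.B5G183RateW1BlockC
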